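import Literature.Computability.QuantumComplexity.HidingProgram
import Literature.Computability.QuantumComplexity.GramSchmidtRoundingMachine
import HarnessLib

/-!
# The hiding program is polynomial time: `CodeFP` certificates of the pre-processing

Family `quantum-advantage`, sequel of `HidingProgram.lean` (the list program of the `FBPP^{NP^𝒪}`
machine of the discharge of Aaronson–Arkhipov's Thm. 1.3). This file proves that the
pre-processing `preFun H p₀ c_𝒪 c_S : (query, coins) ↦` Stockmeyer query is computed on codes by a
polynomial-time string function (`preFun_codeFP`), by assembling the typed `CodeFP` certificates of
its stages:

* generic bricks: unary products and polynomials (`unMul_codeFP`, `unPoly_codeFP`,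
  `strPolyLen_codeFP`), the size of a numeral (`natSizeU_codeFP`), the power-of-two budgets
  (`two_pow_size_le'`, `HPolys.m_codeFP`, `HPolys.mmax_le`);
* the scalars and parameters read off the input (`nC_codeFP`, …, `HPolys.ctx_codeFP`,
  `HPolys.coinLen_codeFP`);
* the stages: `posL_codeFP`, `coinRowsL_codeFP` (around `samplerOf_codeFP`), `overwriteL_codeFP`,
  `hiddenL_codeFP` (around `roundedGS_codeFP`), `queryL_codeFP`, `instL_codeFP`;
* the assembly `plantedTop_codeFP`, `queryTop_codeFP`, `instTop_codeFP`, `ellTop_codeFP`,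
  `sclTop_codeFP`, **`preFun_codeFP`**.

All proved, no new named facts.

## References

* S. Aaronson, A. Arkhipov, *The computational complexity of linear optics*, Theory of Computing 9
  (2013) 143–252, proof of Thm. 1.3, §5.2 (pp. 192–195).
* S. Arora, B. Barak, *Computational Complexity: A Modern Approach*, CUP 2009, §1.3 (polynomial
  time is closed under composition and polynomially bounded loops).
-/

namespace Literature.Computability.QuantumComplexity

open Polynomial Literature.Computability.Complexity Literature.Computability.Complexity.CodeFP
  Literature.Computability.Cryptography Literature.Probability.Distributions

/-! ### Generic bricks -/

/-- Unary multiplication. [folklore] -/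
theorem unMul_codeFP : CodeFP (pairE unE unE) unE (fun p => p.1 * p.2) := by
  have h : CodeFP (pairE unE unE) unE
      (fun p => (List.replicate ((List.replicate p.1 ()).length * (List.replicate p.2 ()).length) ()).length) := by
    exact ((ulength unitE).comp (unitsMul.comp ((replicateUnit.comp (fst _ _)).pair (replicateUnit.comp (snd _ _)))) :)
  exact h.congr fun p => by simp

/-- A fixed polynomial of a unary numeral, in unary (`Plumb.polyFn`). [folklore] -/
theorem unPoly_codeFP (Q : Polynomial ℕ) : CodeFP unE unE (fun n => Q.eval n) :=
  ⟨Plumb.polyFn Q, Plumb.polyFn_mem_FP Q, fun n => by rw [Plumb.polyFn_apply, length_unE, unE_eq_ones]⟩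

/-- A fixed polynomial of the length of a string, in unary. [folklore] -/
theorem strPolyLen_codeFP (Q : Polynomial ℕ) : CodeFP strE unE (fun s => Q.eval s.length) :=
  ⟨Plumb.polyFn Q, Plumb.polyFn_mem_FP Q, fun s => by rw [Plumb.polyFn_apply, unE_eq_ones]; rfl⟩

/-- The size of a binary numeral is the length of its code, in unary. [folklore] -/
theorem natSizeU_codeFP : CodeFP natE unE Nat.size :=
  ⟨onesFn, onesFn_mem_FP, fun n => by change unE (natE n).length = unE (Nat.size n); rw [length_natE]⟩

/-- Decoding an arbitrary answer string as a number (`Brick.canonF`). [folklore] -/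
theorem decodeNat_codeFP : CodeFP strE natE Computability.decodeNat :=
  ⟨Brick.canonF, Brick.canonF_mem_FP, fun w => Brick.canonF_eq_encodeNat_decodeNat w⟩

/-- `2^{size x} ≤ 2x` for `x ≥ 1`. [folklore] -/
theorem two_pow_size_le' {x : ℕ} (hx : 0 < x) : 2 ^ Nat.size x ≤ 2 * x := by
  have h1 : 0 < Nat.size x := Nat.size_pos.2 hx
  have h2 : 2 ^ (Nat.size x - 1) ≤ x := Nat.lt_size.1 (by omega)
  have : 2 ^ Nat.size x = 2 * 2 ^ (Nat.size x - 1) := by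
    rw [← pow_succ']; congr 1; omega
  omega

/-- A power of two read in unary against a budget that is never active. [folklore] -/
theorem unPowBudget_codeFP {α : Type} {eα : α → List Bool} {t : α → ℕ} {B : α → ℕ}
    (ht : CodeFP eα unE t) (hB : CodeFP eα unE B) (hle : ∀ a, 2 ^ t a ≤ B a) :
    CodeFP eα unE (fun a => 2 ^ t a) := by
  have h : CodeFP eα unE (fun a => min (2 ^ t a) (B a)) := by
    exact (unOfNatMin.comp (hB.pair (natPow.comp ((const _ 2).pair ht))) :)
  exact h.congr fun a => min_eq_left (hle a)

namespace HPolys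

variable (H : HPolys)

/-- `r₀` is computed in unary. [folklore] -/
theorem r₀_codeFP : CodeFP unE unE r₀ := by
  have h1 : CodeFP unE unE (fun N => Nat.size N + 1) := by
    exact (unSucc.comp (natSizeU_codeFP.comp natOfUn) :)
  have h2 : CodeFP unE unE (fun N => Nat.size (Nat.size N + 1) + 3) := by
    exact (unAdd.comp ((natSizeU_codeFP.comp (natOfUn.comp h1)).pair (const _ 3)) :)
  exact h2.congr fun N => rfl

/-- `μ` is computed in unary. [folklore] -/
theorem μ_codeFP : CodeFP unE unE H.μ := by
  exact ((natSizeU_codeFP.comp (natOfUn.comp (unPoly_codeFP H.mP))).congr fun N => rfl :)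

/-- `m = 2^μ` is computed in unary (it is at most `2 mP(N) + 1`). [folklore] -/
theorem m_codeFP : CodeFP unE unE H.m := by
  refine unPowBudget_codeFP H.μ_codeFP (unPoly_codeFP (2 * H.mP + 1)) fun N => ?_
  simp only [HPolys.μ, eval_add, eval_mul, eval_ofNat, eval_one]
  rcases Nat.eq_zero_or_pos (H.mP.eval N) with h | h
  · rw [h]; simp
  · exact (two_pow_size_le' h).trans (Nat.le_succ _)

/-- `k` is computed in unary. [folklore] -/
theorem k_codeFP : CodeFP unE unE H.k := by
  exact ((natSizeU_codeFP.comp (natOfUn.comp (unPoly_codeFP H.kP))).congr fun N => rfl :)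

/-- `J` is computed in unary. [folklore] -/
theorem J_codeFP : CodeFP unE unE H.J := unPoly_codeFP H.JP

/-- `kβ` is computed in unary. [folklore] -/
theorem kβ_codeFP : CodeFP unE unE H.kβ := unPoly_codeFP H.kβP

/-- `kη` is computed in unary. [folklore] -/
theorem kη_codeFP : CodeFP unE unE H.kη := unPoly_codeFP H.kηP

/-- `kδS` is computed in unary. [folklore] -/
theorem kδS_codeFP : CodeFP unE unE H.kδS := unPoly_codeFP H.kδSP

/-- `b_q` is computed in unary. [folklore] -/
theorem bq_codeFP (p₀ : Polynomial ℕ) : CodeFP unE unE (H.bq p₀) := by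
  exact (((unPoly_codeFP p₀).comp (unAdd.comp (H.m_codeFP.pair H.kβ_codeFP))).congr fun N => rfl :)

/-- `2^{r₀} ≤ 16 (N + 1)`. [folklore] -/
theorem two_pow_r₀_le (N : ℕ) : 2 ^ r₀ N ≤ 16 * (N + 1) := by
  unfold r₀
  rw [pow_add]
  have h1 := two_pow_size_le' (x := Nat.size N + 1) (by omega)
  have h2 : Nat.size N ≤ N := Nat.size_le.2 Nat.lt_two_pow_self
  calc 2 ^ Nat.size (Nat.size N + 1) * 2 ^ 3 ≤ (2 * (Nat.size N + 1)) * 8 := by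
        exact Nat.mul_le_mul h1 (by norm_num)
    _ ≤ 16 * (N + 1) := by omega

/-- The polynomial budget of the sampler's `Mmax`. [folklore] -/
noncomputable def mmaxBudget : Polynomial ℕ := 256 * (X + 1) ^ 2 * (2 * H.kP + 1)

/-- **The sampler's `Mmax = 2^{2r₀ + k}` is polynomially bounded**: `≤ 256 (N+1)² (2 kP(N) + 1)`.
[folklore] -/
theorem mmax_le (N : ℕ) : 2 ^ (2 * r₀ N + H.k N) ≤ H.mmaxBudget.eval N := by
  simp only [mmaxBudget, eval_mul, eval_ofNat, eval_pow, eval_add, eval_X, eval_one]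
  rw [pow_add, pow_mul']
  have h1 := two_pow_r₀_le N
  have h2 : 2 ^ H.k N ≤ 2 * H.kP.eval N + 1 := by
    unfold HPolys.k
    rcases Nat.eq_zero_or_pos (H.kP.eval N) with h | h
    · rw [h]; simp
    · exact (two_pow_size_le' h).trans (Nat.le_succ _)
  calc (2 ^ r₀ N) ^ 2 * 2 ^ H.k N ≤ (16 * (N + 1)) ^ 2 * (2 * H.kP.eval N + 1) :=
        Nat.mul_le_mul (Nat.pow_le_pow_left h1 2) h2
    _ = 256 * (N + 1) ^ 2 * (2 * eval N H.kP + 1) := by ring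

/-- `Mmax` as a function of `(b, N)`, in unary. [folklore] -/
theorem mmax_codeFP : CodeFP (pairE unE unE) unE (fun p => 2 ^ (2 * r₀ p.2 + H.k p.2)) := by
  have hN : CodeFP (pairE unE unE) unE (fun p => p.2) := snd _ _
  have hr : CodeFP (pairE unE unE) unE (fun p => r₀ p.2) := by exact (r₀_codeFP.comp hN :)
  have hk : CodeFP (pairE unE unE) unE (fun p => H.k p.2) := by exact (H.k_codeFP.comp hN :)
  have ht' : CodeFP (pairE unE unE) unE (fun p => r₀ p.2 + r₀ p.2 + H.k p.2) := by
    exact (unAdd.comp ((unAdd.comp (hr.pair hr)).pair hk) :)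
  have ht : CodeFP (pairE unE unE) unE (fun p => 2 * r₀ p.2 + H.k p.2) := ht'.congr fun p => by ring
  have hB : CodeFP (pairE unE unE) unE (fun p => H.mmaxBudget.eval p.2) := by
    exact ((unPoly_codeFP H.mmaxBudget).comp hN :)
  exact unPowBudget_codeFP ht hB fun p => H.mmax_le p.2

/-- The sampler's coin length `L_c = J · (r₀ + b + 1 + Mmax · k)` as a function of `(b, N)`, in
unary. [folklore] -/
theorem coinLen_codeFP : CodeFP (pairE unE unE) unE (fun p => (H.pg p.1 p.2).coinLen) := by
  have hb : CodeFP (pairE unE unE) unE (fun p => p.1) := fst _ _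
  have hN : CodeFP (pairE unE unE) unE (fun p => p.2) := snd _ _
  have hr : CodeFP (pairE unE unE) unE (fun p => r₀ p.2) := by exact (r₀_codeFP.comp hN :)
  have hk : CodeFP (pairE unE unE) unE (fun p => H.k p.2) := by exact (H.k_codeFP.comp hN :)
  have hmm : CodeFP (pairE unE unE) unE (fun p => 2 ^ (2 * r₀ p.2 + H.k p.2)) := H.mmax_codeFP
  have hhdr : CodeFP (pairE unE unE) unE (fun p => r₀ p.2 + p.1 + 1) := by
    exact (unSucc.comp (unAdd.comp (hr.pair hb)) :)
  have hatt : CodeFP (pairE unE unE) unE (fun p => r₀ p.2 + p.1 + 1 + 2 ^ (2 * r₀ p.2 + H.k p.2) * H.k p.2) := by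
    exact (unAdd.comp (hhdr.pair (unMul_codeFP.comp (hmm.pair hk))) :)
  have h : CodeFP (pairE unE unE) unE (fun p => H.J p.2 * (r₀ p.2 + p.1 + 1 + 2 ^ (2 * r₀ p.2 + H.k p.2) * H.k p.2)) := by
    exact (unMul_codeFP.comp ((H.J_codeFP.comp hN).pair hatt) :)
  exact h.congr fun p => rfl

/-- The sampler's record `(hdrLen, k, Mmax, J, attLen, T, 2ᵏ, 4ᵇ)` as a function of `(b, N)`.
[folklore] -/
theorem ctx_codeFP : CodeFP (pairE unE unE) samplerCtxE (fun p => (H.pg p.1 p.2).ctx) := by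
  have hb : CodeFP (pairE unE unE) unE (fun p => p.1) := fst _ _
  have hN : CodeFP (pairE unE unE) unE (fun p => p.2) := snd _ _
  have hr : CodeFP (pairE unE unE) unE (fun p => r₀ p.2) := by exact (r₀_codeFP.comp hN :)
  have hk : CodeFP (pairE unE unE) unE (fun p => H.k p.2) := by exact (H.k_codeFP.comp hN :)
  have hJ : CodeFP (pairE unE unE) unE (fun p => H.J p.2) := by exact (H.J_codeFP.comp hN :)
  have hmm : CodeFP (pairE unE unE) unE (fun p => 2 ^ (2 * r₀ p.2 + H.k p.2)) := H.mmax_codeFP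
  have hhdr : CodeFP (pairE unE unE) unE (fun p => r₀ p.2 + p.1 + 1) := by
    exact (unSucc.comp (unAdd.comp (hr.pair hb)) :)
  have hatt : CodeFP (pairE unE unE) unE (fun p => r₀ p.2 + p.1 + 1 + 2 ^ (2 * r₀ p.2 + H.k p.2) * H.k p.2) := by
    exact (unAdd.comp (hhdr.pair (unMul_codeFP.comp (hmm.pair hk))) :)
  have hT : CodeFP (pairE unE unE) natE (fun p => 2 ^ (r₀ p.2 + p.1)) := by
    exact (natPow.comp ((const _ 2).pair (unAdd.comp (hr.pair hb))) :)
  have hpk : CodeFP (pairE unE unE) natE (fun p => 2 ^ H.k p.2) := by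
    exact (natPow.comp ((const _ 2).pair hk) :)
  have hfb : CodeFP (pairE unE unE) natE (fun p => 4 ^ p.1) := by
    exact (natPow.comp ((const _ 4).pair hb) :)
  have h : CodeFP (pairE unE unE) samplerCtxE (fun p => (r₀ p.2 + p.1 + 1, H.k p.2, 2 ^ (2 * r₀ p.2 + H.k p.2), H.J p.2,
      r₀ p.2 + p.1 + 1 + 2 ^ (2 * r₀ p.2 + H.k p.2) * H.k p.2, 2 ^ (r₀ p.2 + p.1), 2 ^ H.k p.2, 4 ^ p.1)) := by
    exact (hhdr.pair (hk.pair (hmm.pair (hJ.pair (hatt.pair (hT.pair (hpk.pair hfb)))))) :)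
  exact h.congr fun p => rfl

end HPolys

/-! ### The input code and the clipped scalars -/

/-- The code of the query tuple `(n, b, kε, kδ, rows)`: binary scalars, the rows in the wire format of
`encodeGPEQuery` (headed lists of sign–magnitude integer pairs). [folklore] -/
abbrev ginE : GIn → List Bool := pairE natE (pairE natE (pairE natE (pairE natE (listE (listE (pairE smE smE))))))

/-- The code of `(query, coins)`. [folklore] -/
abbrev inE : GIn × List Bool → List Bool := pairE ginE strE

/-- The coin length, in unary. [folklore] -/
theorem rlen_codeFP : CodeFP inE unE (fun q => q.2.length) := by exact (strLength.comp (snd _ _) :)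

/-- `nC` in unary. [folklore] -/
theorem nC_codeFP : CodeFP inE unE (fun q => q.1.nC q.2) := by
  exact ((unOfNatMin.comp (rlen_codeFP.pair (fst _ _).fst')).congr fun q => rfl :)

/-- `bC` in unary. [folklore] -/
theorem bC_codeFP : CodeFP inE unE (fun q => q.1.bC q.2) := by
  exact ((unOfNatMin.comp (rlen_codeFP.pair (fst _ _).snd'.fst')).congr fun q => rfl :)

/-- `NC` in unary. [folklore] -/
theorem NC_codeFP : CodeFP inE unE (fun q => q.1.NC q.2) := by
  have h : CodeFP inE natE (fun q => q.1.1 + q.1.2.2.1 + q.1.2.2.2.1) := by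
    exact (natAdd.comp ((natAdd.comp ((fst _ _).fst'.pair (fst _ _).snd'.snd'.fst')).pair
      (fst _ _).snd'.snd'.snd'.fst') :)
  exact ((unOfNatMin.comp (rlen_codeFP.pair h)).congr fun q => rfl :)

/-- Sign–magnitude pairs to two's-free integer pairs (`giE`). [folklore] -/
theorem giOfSm_codeFP : CodeFP (pairE smE smE) giE id := by
  have h : CodeFP (pairE smE smE) giE (fun z => (z.1, z.2)) := by
    exact ((intOfSM.comp (fst _ _)).pair (intOfSM.comp (snd _ _)) :)
  exact h.congr fun z => rfl

/-- Integer pairs back to the wire format. [folklore] -/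
theorem smOfGi_codeFP : CodeFP giE (pairE smE smE) id := by
  have h : CodeFP giE (pairE smE smE) (fun z => (z.1, z.2)) := by
    exact ((smOfInt.comp (fst _ _)).pair (smOfInt.comp (snd _ _)) :)
  exact h.congr fun z => rfl

/-- The rows of `X̃` as raw lists of `giE` items. [folklore] -/
theorem rows_codeFP : CodeFP inE (rawE (rawE giE)) (fun q => q.1.rows) := by
  have hconv : CodeFP (listE (listE (pairE smE smE))) (rawE (rawE giE)) id := by
    have h1 : CodeFP (listE (pairE smE smE)) (rawE giE) (fun l => (id l).map id) := by
      exact ((map₀ giOfSm_codeFP).comp (rawOfList _) :)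
    have h2 : CodeFP (listE (listE (pairE smE smE))) (rawE (rawE giE)) (fun L => (id L).map fun l => (id l).map id) := by
      exact ((map₀ h1).comp (rawOfList _) :)
    exact h2.congr fun L => by simp
  exact ((hconv.comp (fst _ _).snd'.snd'.snd'.snd').congr fun q => rfl :)

/-! ### Stage bricks -/

/-- **Positions.** [folklore] -/
theorem posL_codeFP : CodeFP (pairE unE (pairE unE strE)) (rawE natE) (fun p => posL p.1 p.2.1 p.2.2) := by
  have h := (map₀ strVal).comp strChunks
  exact h.congr fun p => by simp only [posL, List.map_map]; rfl

/-- **One entry from its coin block.** [folklore] -/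
theorem entryPairOf_codeFP :
    CodeFP (pairE samplerCtxE (pairE unE strE)) giE (fun p => entryPairOf p.1 p.2.1 p.2.2) := by
  have hc : CodeFP (pairE samplerCtxE (pairE unE strE)) samplerCtxE (fun p => p.1) := fst _ _
  have hL : CodeFP (pairE samplerCtxE (pairE unE strE)) unE (fun p => p.2.1) := (snd _ _).fst'
  have ha : CodeFP (pairE samplerCtxE (pairE unE strE)) strE (fun p => p.2.2) := (snd _ _).snd'
  have h1 : CodeFP (pairE samplerCtxE (pairE unE strE)) intE (fun p => samplerOf p.1 (p.2.2.take p.2.1)) := by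
    exact (samplerOf_codeFP.comp (hc.pair (strTake.comp (hL.pair ha))) :)
  have h2 : CodeFP (pairE samplerCtxE (pairE unE strE)) intE
      (fun p => samplerOf p.1 ((p.2.2.drop p.2.1).take p.2.1)) := by
    exact (samplerOf_codeFP.comp (hc.pair (strTake.comp (hL.pair (strDrop.comp (hL.pair ha))))) :)
  exact ((h1.pair h2).congr fun p => rfl :)

/-- The code of the arguments `(c, L_c, m, n, w)` of `coinRowsL`. [folklore] -/
abbrev coinRowsArgE : SamplerCtx × ℕ × ℕ × ℕ × List Bool → List Bool :=
  pairE samplerCtxE (pairE unE (pairE unE (pairE unE strE)))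

/-- **The sampler array.** [folklore] -/
theorem coinRowsL_codeFP :
    CodeFP coinRowsArgE (rawE (rawE giE)) (fun p => coinRowsL p.1 p.2.1 p.2.2.1 p.2.2.2.1 p.2.2.2.2) := by
  -- contexts `σ = (c, L_c, n)`
  let σE : SamplerCtx × ℕ × ℕ → List Bool := pairE samplerCtxE (pairE unE unE)
  have hin : CodeFP (pairE σE strE) (rawE giE)
      (fun t => ((List.range t.1.2.2).map fun j => (t.2.drop (j * (2 * t.1.2.1))).take (2 * t.1.2.1)).map
        fun a => entryPairOf t.1.1 t.1.2.1 a) := by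
    have h2L' : CodeFP (pairE σE strE) unE (fun t => t.1.2.1 + t.1.2.1) := by
      exact (unAdd.comp ((fst _ _).snd'.fst'.pair (fst _ _).snd'.fst') :)
    have h2L : CodeFP (pairE σE strE) unE (fun t => 2 * t.1.2.1) := h2L'.congr fun t => by ring
    have hch : CodeFP (pairE σE strE) (rawE strE)
        (fun t => (List.range t.1.2.2).map fun j => (t.2.drop (j * (2 * t.1.2.1))).take (2 * t.1.2.1)) := by
      exact (strChunks.comp ((fst _ _).snd'.snd'.pair (h2L.pair (snd _ _))) :)
    have hctx : CodeFP (pairE σE strE) (pairE samplerCtxE unE) (fun t => (t.1.1, t.1.2.1)) := by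
      exact ((fst _ _).fst'.pair (fst _ _).snd'.fst' :)
    exact ((map (σ := SamplerCtx × ℕ) (α := List Bool) (g := fun s => entryPairOf s.1.1 s.1.2 s.2)
      (entryPairOf_codeFP.comp ((fst _ _).fst'.pair ((fst _ _).snd'.pair (snd _ _))))).comp (hctx.pair hch) :)
  have hσ : CodeFP coinRowsArgE σE (fun p => (p.1, p.2.1, p.2.2.2.1)) := by
    exact ((fst _ _).pair ((snd _ _).fst'.pair (snd _ _).snd'.snd'.fst') :)
  have hrowlen : CodeFP coinRowsArgE unE (fun p => p.2.2.2.1 * (2 * p.2.1)) := by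
    have h2L' : CodeFP coinRowsArgE unE (fun p => p.2.1 + p.2.1) := by
      exact (unAdd.comp ((snd _ _).fst'.pair (snd _ _).fst') :)
    have h2L : CodeFP coinRowsArgE unE (fun p => 2 * p.2.1) := h2L'.congr fun p => by ring
    exact (unMul_codeFP.comp ((snd _ _).snd'.snd'.fst'.pair h2L) :)
  have hrows : CodeFP coinRowsArgE (rawE strE)
      (fun p => (List.range p.2.2.1).map fun i => (p.2.2.2.2.drop (i * (p.2.2.2.1 * (2 * p.2.1)))).take
        (p.2.2.2.1 * (2 * p.2.1))) := by
    exact (strChunks.comp ((snd _ _).snd'.fst'.pair (hrowlen.pair (snd _ _).snd'.snd'.snd')) :)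
  have h := (map hin).comp (hσ.pair hrows)
  refine h.congr fun p => ?_
  simp only [coinRowsL, List.map_map]
  rfl

/-- The fold of the planting step keeps the accumulator among the initial row and the planted rows.
[folklore] -/
theorem foldl_plant_mem {α : Type*} (ρ : ℕ) : ∀ (l : List (ℕ × List α)) (row : List α),
    l.foldl (fun acc sx => if sx.1 = ρ then sx.2 else acc) row ∈ row :: l.map Prod.snd
  | [], row => by simp
  | sx :: l, row => by
    rw [List.foldl_cons]
    have h := foldl_plant_mem ρ l (if sx.1 = ρ then sx.2 else row)
    rcases List.mem_cons.1 h with h | h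
    · rw [h]
      split_ifs
      · simp
      · simp
    · exact List.mem_cons_of_mem _ (by simpa using Or.inr h)

/-- **Planting.** [folklore] -/
theorem overwriteL_codeFP :
    CodeFP (pairE (rawE (rawE giE)) (pairE (rawE natE) (rawE (rawE giE)))) (rawE (rawE giE))
      (fun p => overwriteL p.1 p.2.1 p.2.2) := by
  -- the zipped plantings `(S_i, x_i)`
  have hzip : CodeFP (pairE (rawE (rawE giE)) (pairE (rawE natE) (rawE (rawE giE)))) (rawE (pairE natE (rawE giE)))
      (fun p => List.zipWith (fun s x => (s, x)) p.2.1 p.2.2) := by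
    have hz := zipWith (σ := Unit) (eσ := unitE) (eα := natE) (eβ := rawE giE) (eγ := pairE natE (rawE giE))
      (g := fun t => (t.2.1, t.2.2)) ((snd _ _).fst'.pair (snd _ _).snd')
    exact (hz.comp ((const _ ()).pair ((snd _ _).fst'.pair (snd _ _).snd')) :)
  -- the inner fold, context `(ρ, row)`, over the zipped plantings
  have hstep : CodeFP (pairE (pairE natE (rawE giE)) (pairE (pairE natE (rawE giE)) (rawE giE))) (rawE giE)
      (fun t => if decide (t.2.1.1 = t.1.1) then t.2.1.2 else t.2.2) := by
    exact ((natEq.comp ((snd _ _).fst'.fst'.pair (fst _ _).fst')).ite (snd _ _).fst'.snd' (snd _ _).snd' :)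
  have hfold : CodeFP (pairE (pairE natE (rawE giE)) (rawE (pairE natE (rawE giE)))) (rawE giE)
      (fun p => p.2.foldl (fun acc sx => if decide (sx.1 = p.1.1) then sx.2 else acc) p.1.2) := by
    refine foldl (σ := ℕ × List (ℤ × ℤ)) (α := ℕ × List (ℤ × ℤ)) (β := List (ℤ × ℤ))
      (step := fun s sx acc => if decide (sx.1 = s.1) then sx.2 else acc) (init := fun s => s.2) hstep (snd _ _) X
      fun s l₁ l₂ => ?_
    obtain ⟨ρ, row⟩ := s
    dsimp only
    rw [eval_X, pairE_apply, length_boolPair, pairE_apply, length_boolPair]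
    have hmem := foldl_plant_mem ρ l₁ row
    simp only [decide_eq_true_eq]
    rcases List.mem_cons.1 hmem with h | h
    · rw [h]; omega
    · obtain ⟨sx, hsx, hx⟩ := List.mem_map.1 h
      rw [← hx]
      have h1 := length_item_le_length_rawE (pairE natE (rawE giE)) (List.mem_append_left l₂ hsx)
      rw [pairE_apply, length_boolPair] at h1
      omega
  -- the outer map over the enumerated rows, context the zipped plantings
  have hg : CodeFP (pairE (rawE (pairE natE (rawE giE))) (pairE natE (rawE giE))) (rawE giE)
      (fun t => t.1.foldl (fun acc sx => if decide (sx.1 = t.2.1) then sx.2 else acc) t.2.2) := by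
    exact (hfold.comp ((snd _ _).pair (fst _ _)) :)
  have h := (map hg).comp (hzip.pair ((rawEnum (rawE giE)).comp (fst _ _)))
  refine h.congr fun p => ?_
  simp only [overwriteL, decide_eq_true_eq]

/-- Clamping an integer. [folklore] -/
theorem clampZ_codeFP : CodeFP (pairE natE intE) intE (fun p => clampZ p.1 p.2) := by
  have hK : CodeFP (pairE natE intE) intE (fun p => (p.1 : ℤ)) := by exact (intOfNat.comp (fst _ _) :)
  have hnK : CodeFP (pairE natE intE) intE (fun p => -(p.1 : ℤ)) := by exact (intNeg.comp hK :)
  have hz : CodeFP (pairE natE intE) intE (fun p => p.2) := snd _ _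
  have hmin : CodeFP (pairE natE intE) intE (fun p => if decide ((p.1 : ℤ) ≤ p.2) then (p.1 : ℤ) else p.2) := by
    exact ((intLe.comp (hK.pair hz)).ite hK hz :)
  have hmax : CodeFP (pairE natE intE) intE (fun p => if decide (-(p.1 : ℤ) ≤ if decide ((p.1 : ℤ) ≤ p.2) then (p.1 : ℤ) else p.2)
      then (if decide ((p.1 : ℤ) ≤ p.2) then (p.1 : ℤ) else p.2) else -(p.1 : ℤ)) := by
    exact ((intLe.comp (hnK.pair hmin)).ite hmin hnK :)
  refine hmax.congr fun p => ?_
  simp only [clampZ, decide_eq_true_eq, min_def, max_def]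

/-- Clamping a pair. [folklore] -/
theorem clampPair_codeFP : CodeFP (pairE natE giE) giE (fun p => clampPair p.1 p.2) := by
  have h : CodeFP (pairE natE giE) giE (fun p => (clampZ p.1 p.2.1, clampZ p.1 p.2.2)) := by
    exact ((clampZ_codeFP.comp ((fst _ _).pair (snd _ _).fst')).pair (clampZ_codeFP.comp ((fst _ _).pair (snd _ _).snd')) :)
  exact h.congr fun p => rfl

/-- **The hidden matrix code** `(b_q, rows, n) ↦ hiddenL b_q rows n`. [folklore] -/
theorem hiddenL_codeFP :
    CodeFP (pairE unE (pairE (rawE (rawE giE)) unE)) (rawE (rawE giE)) (fun p => hiddenL p.1 p.2.1 p.2.2) := by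
  have hgs : CodeFP (pairE unE (pairE (rawE (rawE giE)) unE)) (rawE (rawE giE)) (fun p => roundedGS p.1 p.2.1 p.2.2) := by
    exact (roundedGS_codeFP.comp ((fst _ _).pair ((snd _ _).snd'.pair (snd _ _).fst')) :)
  have hK : CodeFP (pairE unE (pairE (rawE (rawE giE)) unE)) natE (fun p => 2 ^ p.1) := by
    exact (natPow.comp ((const _ 2).pair (fst _ _)) :)
  have hrow : CodeFP (pairE natE (rawE giE)) (rawE giE) (fun t => t.2.map fun z => clampPair t.1 z) := map clampPair_codeFP
  have h : CodeFP (pairE unE (pairE (rawE (rawE giE)) unE)) (rawE (rawE giE))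
      (fun p => (roundedGS p.1 p.2.1 p.2.2).map fun row => row.map fun z => clampPair (2 ^ p.1) z) := by
    exact ((map (g := fun t : ℕ × List (ℤ × ℤ) => t.2.map fun z => clampPair t.1 z) hrow).comp (hK.pair hgs) :)
  exact h.congr fun p => rfl

/-- The code of the arguments `(n, e, b_q, kβ, E)` of `queryL`: three binary, one unary, raw rows. [folklore] -/
abbrev queryArgE : ℕ × ℕ × ℕ × ℕ × List (List (ℤ × ℤ)) → List Bool :=
  pairE natE (pairE natE (pairE natE (pairE unE (rawE (rawE giE)))))

/-- **The padded oracle query.** [folklore] -/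
theorem queryL_codeFP : CodeFP queryArgE strE (fun p => queryL p.1 p.2.1 p.2.2.1 p.2.2.2.1 p.2.2.2.2) := by
  have hconv : CodeFP (rawE (rawE giE)) (listE (listE (pairE smE smE))) id := by
    have h1 : CodeFP (rawE giE) (listE (pairE smE smE)) (fun l => id (l.map id)) := by
      exact ((listOfRaw _).comp (map₀ smOfGi_codeFP) :)
    have h2 : CodeFP (rawE (rawE giE)) (listE (listE (pairE smE smE))) (fun L => id (L.map fun l => id (l.map id))) := by
      exact ((listOfRaw _).comp (map₀ h1) :)
    exact h2.congr fun L => by simp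
  have h : CodeFP queryArgE (pairE (pairE natE (pairE natE (pairE natE (listE (listE (pairE smE smE)))))) unE)
      (fun p => ((p.1, p.2.1, p.2.2.1, id p.2.2.2.2), p.2.2.2.1)) := by
    exact (((fst _ _).pair ((snd _ _).fst'.pair ((snd _ _).snd'.fst'.pair (hconv.comp (snd _ _).snd'.snd'.snd')))).pair
      (snd _ _).snd'.snd'.fst' :)
  exact h.recodeOut fun p => rfl

/-- **The counting instance.** [folklore] -/
theorem instL_codeFP : CodeFP (pairE strE (rawE natE)) strE (fun p => instL p.1 p.2) := by
  have h : CodeFP (pairE strE (rawE natE)) (pairE strE (listE natE)) (fun p => (p.1, id p.2)) := by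
    exact ((fst _ _).pair ((listOfRaw natE).comp (snd _ _)) :)
  exact h.recodeOut fun p => rfl

/-! ### The assembly of the pre-processing -/

section Top

variable (H : HPolys) (p₀ cO cS : Polynomial ℕ)

/-- `μ(N)` on the input. [folklore] -/
theorem muTop_codeFP : CodeFP inE unE (fun q => H.μ (q.1.NC q.2)) := by exact (H.μ_codeFP.comp NC_codeFP :)

/-- `m(N)` on the input. [folklore] -/
theorem mTop_codeFP : CodeFP inE unE (fun q => H.m (q.1.NC q.2)) := by exact (H.m_codeFP.comp NC_codeFP :)

/-- The sampler's coin length on the input. [folklore] -/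
theorem coinLenTop_codeFP : CodeFP inE unE (fun q => (pgOf H q.1 q.2).coinLen) := by
  exact ((H.coinLen_codeFP.comp (bC_codeFP.pair NC_codeFP)).congr fun q => rfl :)

/-- The sampler's record on the input. [folklore] -/
theorem ctxTop_codeFP : CodeFP inE samplerCtxE (fun q => (pgOf H q.1 q.2).ctx) := by
  exact ((H.ctx_codeFP.comp (bC_codeFP.pair NC_codeFP)).congr fun q => rfl :)

/-- The length of the position field. [folklore] -/
theorem lenS_codeFP : CodeFP inE unE (fun q => q.1.nC q.2 * H.μ (q.1.NC q.2)) := by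
  exact (unMul_codeFP.comp (nC_codeFP.pair (muTop_codeFP H)) :)

/-- The length of the array field. [folklore] -/
theorem lenB_codeFP : CodeFP inE unE (fun q => H.m (q.1.NC q.2) * (q.1.nC q.2 * (2 * (pgOf H q.1 q.2).coinLen))) := by
  have h2' : CodeFP inE unE (fun q => (pgOf H q.1 q.2).coinLen + (pgOf H q.1 q.2).coinLen) := by
    exact (unAdd.comp ((coinLenTop_codeFP H).pair (coinLenTop_codeFP H)) :)
  have h2 : CodeFP inE unE (fun q => 2 * (pgOf H q.1 q.2).coinLen) := h2'.congr fun q => by ring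
  exact (unMul_codeFP.comp ((mTop_codeFP H).pair (unMul_codeFP.comp (nC_codeFP.pair h2))) :)

/-- The three coin fields. [folklore] -/
theorem coinsS_codeFP : CodeFP inE strE (fun q => coinsS H q.1 q.2) := by
  exact ((strTake.comp ((lenS_codeFP H).pair (snd _ _))).congr fun q => rfl :)

/-- The three coin fields. [folklore] -/
theorem coinsB_codeFP : CodeFP inE strE (fun q => coinsB H q.1 q.2) := by
  exact ((strTake.comp ((lenB_codeFP H).pair (strDrop.comp ((lenS_codeFP H).pair (snd _ _))))).congr fun q => rfl :)

/-- The three coin fields. [folklore] -/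
theorem coinsU_codeFP : CodeFP inE strE (fun q => coinsU H q.1 q.2) := by
  exact ((strDrop.comp ((unAdd.comp ((lenS_codeFP H).pair (lenB_codeFP H))).pair (snd _ _))).congr fun q => rfl :)


attribute [local irreducible] coinsS coinsB coinsU
/-- **The positions on the input.** [folklore] -/
theorem posTop_codeFP : CodeFP inE (rawE natE) (fun q => posTop H q.1 q.2) := by
  exact ((posL_codeFP.comp (nC_codeFP.pair ((muTop_codeFP H).pair (coinsS_codeFP H)))).congr fun q => rfl :)


attribute [local irreducible] posTop
/-- **The planted array on the input.** [cite: AaronsonArkhipovToC2013, proof of Thm. 1.3 (p. 194)] -/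
theorem plantedTop_codeFP : CodeFP inE (rawE (rawE giE)) (fun q => plantedTop H q.1 q.2) := by
  have hB : CodeFP inE (rawE (rawE giE))
      (fun q => coinRowsL (pgOf H q.1 q.2).ctx (pgOf H q.1 q.2).coinLen (H.m (q.1.NC q.2)) (q.1.nC q.2) (coinsB H q.1 q.2)) := by
    exact (coinRowsL_codeFP.comp ((ctxTop_codeFP H).pair ((coinLenTop_codeFP H).pair ((mTop_codeFP H).pair
      (nC_codeFP.pair (coinsB_codeFP H))))) :)
  exact ((overwriteL_codeFP.comp (hB.pair ((posTop_codeFP H).pair rows_codeFP))).congr fun q => rfl :)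


attribute [local irreducible] plantedTop
/-- **The hidden matrix code on the input.** [cite: AaronsonArkhipovToC2013, §5.2 (p. 192)] -/
theorem hiddenTop_codeFP : CodeFP inE (rawE (rawE giE)) (fun q => hiddenTop H p₀ q.1 q.2) := by
  exact ((hiddenL_codeFP.comp (((H.bq_codeFP p₀).comp NC_codeFP).pair ((plantedTop_codeFP H).pair nC_codeFP))).congr
    fun q => rfl :)


attribute [local irreducible] hiddenTop
/-- **The padded oracle query on the input.** [cite: AaronsonArkhipovToC2013, proof of Thm. 1.3 (p. 193)] -/
theorem queryTop_codeFP : CodeFP inE strE (fun q => queryTop H p₀ q.1 q.2) := by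
  have hn : CodeFP inE natE (fun q => q.1.nC q.2) := by exact ((natOfUn.comp nC_codeFP).congr fun q => rfl :)
  have hm : CodeFP inE natE (fun q => H.m (q.1.NC q.2)) := by exact ((natOfUn.comp (mTop_codeFP H)).congr fun q => rfl :)
  have he : CodeFP inE natE (fun q => H.m (q.1.NC q.2) - q.1.nC q.2) := by exact (natSub.comp (hm.pair hn) :)
  have hbq : CodeFP inE natE (fun q => H.bq p₀ (q.1.NC q.2)) := by
    exact ((natOfUn.comp ((H.bq_codeFP p₀).comp NC_codeFP)).congr fun q => rfl :)
  have hkβ : CodeFP inE unE (fun q => H.kβ (q.1.NC q.2)) := by exact (H.kβ_codeFP.comp NC_codeFP :)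
  exact ((queryL_codeFP.comp (hn.pair (he.pair (hbq.pair (hkβ.pair (hiddenTop_codeFP H p₀)))))).congr fun q => rfl :)


attribute [local irreducible] queryTop
/-- **The counting instance on the input.** [cite: AaronsonArkhipovToC2013, proof of Thm. 1.3, eq. (5.80) (p. 193)] -/
theorem instTop_codeFP : CodeFP inE strE (fun q => instTop H p₀ q.1 q.2) := by
  exact ((instL_codeFP.comp ((queryTop_codeFP H p₀).pair (posTop_codeFP H))).congr fun q => rfl :)


attribute [local irreducible] instTop
/-- The oracle's coin length on the input, in unary. [folklore] -/
theorem ellTop_codeFP : CodeFP inE unE (fun q => ellTop H p₀ cO q.1 q.2) := by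
  exact (((strPolyLen_codeFP cO).comp (queryTop_codeFP H p₀)).congr fun q => rfl :)


attribute [local irreducible] ellTop
/-- The counter's coin demand on the input, in unary. [folklore] -/
theorem sclTop_codeFP : CodeFP inE unE (fun q => sclTop H p₀ cO cS q.1 q.2) := by
  have h1 : CodeFP inE unE (fun q => (instTop H p₀ q.1 q.2).length) := by
    exact (strLength.comp (instTop_codeFP H p₀) :)
  have h2 : CodeFP inE unE (fun q => (instTop H p₀ q.1 q.2).length + ellTop H p₀ cO q.1 q.2) := by
    exact (unAdd.comp (h1.pair (ellTop_codeFP H p₀ cO)) :)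
  have h3 : CodeFP inE unE (fun q => (instTop H p₀ q.1 q.2).length + ellTop H p₀ cO q.1 q.2 + H.kη (q.1.NC q.2)) := by
    exact (unAdd.comp (h2.pair (H.kη_codeFP.comp NC_codeFP)) :)
  have h : CodeFP inE unE (fun q => (instTop H p₀ q.1 q.2).length + ellTop H p₀ cO q.1 q.2 + H.kη (q.1.NC q.2)
      + H.kδS (q.1.NC q.2)) := by
    exact (unAdd.comp (h3.pair (H.kδS_codeFP.comp NC_codeFP)) :)
  have h4 : CodeFP inE unE (fun q => cS.eval ((instTop H p₀ q.1 q.2).length + ellTop H p₀ cO q.1 q.2 + H.kη (q.1.NC q.2)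
      + H.kδS (q.1.NC q.2))) := by
    exact ((unPoly_codeFP cS).comp h :)
  exact h4.congr fun q => rfl

attribute [local irreducible] sclTop

/-- **The pre-processing of the machine is polynomial time on codes.** [cite: AaronsonArkhipovToC2013, proof of Thm. 1.3 (pp. 193–194)] -/
theorem preFun_codeFP : CodeFP inE strE (preFun H p₀ cO cS) := by
  have hu : CodeFP inE strE (fun q => (coinsU H q.1 q.2).take (sclTop H p₀ cO cS q.1 q.2)) := by
    exact (strTake.comp ((sclTop_codeFP H p₀ cO cS).pair (coinsU_codeFP H)) :)
  have h : CodeFP inE (pairE (pairE strE (pairE unE (pairE unE unE))) strE)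
      (fun q => ((instTop H p₀ q.1 q.2, ellTop H p₀ cO q.1 q.2, H.kη (q.1.NC q.2), H.kδS (q.1.NC q.2)),
        (coinsU H q.1 q.2).take (sclTop H p₀ cO cS q.1 q.2))) := by
    exact (((instTop_codeFP H p₀).pair ((ellTop_codeFP H p₀ cO).pair ((H.kη_codeFP.comp NC_codeFP).pair
      (H.kδS_codeFP.comp NC_codeFP)))).pair hu :)
  exact h.recodeOut fun q => rfl

end Top

end Literature.Computability.QuantumComplexity
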